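import Literature.AlgebraicGeometry.Frobenioids.UnitTrivializationProp48iii
import Literature.AlgebraicGeometry.Frobenioids.BirationalizationIsFrobenioid
import HarnessLib

/-!
# Frobenioids I, Proposition 4.8 (iii) at THE data — unconditional

Mochizuki, *The geometry of Frobenioids I: the general theory*, Kyushu J. Math. **62** (2008)
293–400, Prop. 4.8 (iii) p. 88: "If `C` is of rationally standard type, then `(C^istr)^birat` is of
standard type." [cite: MochizukiFrdI2008, Prop. 4.8 (iii) p.88]

Proof-only closer (node FrdI:Prop4.8(iii); seat abc-iut-L1-d5, lineage duty "U15"). The capstone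
`PreFrobenioidData.prop48iii_rationallyStandard` (this seat, `UnitTrivializationProp48iii.lean`) proved
Prop. 4.8 (iii) at THE Def. 4.5 (iii) data of a Frobenioid `C → F_Φ` CONDITIONALLY on
`hB` = "`(C^istr)^birat → F_{0_D}` is a Frobenioid" (Prop. 4.4 (ii) for `C^istr`). That hypothesis is
now DISCHARGED: by seat abc-iut-w5-d227's `PreFrobenioid.Birat.isFrobenioid` (Prop. 4.4 (ii) in the
author's 2024 form, isotropic case, over seat abc-iut-L6-t20's field lemmas) applied to `C^istr` —
which is of isotropic type (`isOfIsotropicType_istr`) and of birationally Frobenius-normalized type as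
soon as `C` is (this seat's transfer `Birat.isFrobeniusNormalized_istr_of` along the fully faithful
comparison `(C^istr)^birat → C^birat`), the latter being clause (a) of "rationally standard type"
(Def. 4.5 (iii)). The only new ingredient is the remark that Frobenius-normalization of an object of
`C^birat` does not depend on whether the structure functor is taken to be `C^birat → F_{Φ^gp}` or its
composite `C^birat → F_{0_D}` (same `Base`, same `deg_Fr`, hence same `O^▷`).
No statement of the paper is strengthened; nothing here bears on [IUTchIII] Cor. 3.12.
-/

namespace Literature.AlgebraicGeometry.Frobenioids

open CategoryTheory Opposite

universe w v v' u u'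

namespace PreFrobenioid

namespace Birat

variable {D : Type u} [Category.{v} D] {Φ : Dᵒᵖ ⥤ CommMonCat.{w}}
  {C : Type u'} [Category.{v'} C] {F : C ⥤ ElemFrobenioid Φ}

/-- An object of `C^birat` is Frobenius-normalized for the structure functor `C^birat → F_{0_D}`
iff it is Frobenius-normalized for `C^birat → F_{Φ^gp}`: the two functors have the same `Base(-)` and
`deg_Fr(-)` (the former is the latter followed by `F_{Φ^gp} → F_{0_D}`), so the same base-identity
endomorphisms and the same `O^▷` (Def. 1.2 (iv); Prop. 4.4 (i) p. 83).
[cite: MochizukiFrdI2008, Prop. 4.4 (i) p.83] -/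
theorem isFrobeniusNormalized_toElemZero_iff (hF : IsFrobenioid F) (hsq : HasBiratSquares F)
    (X : Birat F hF hsq) :
    IsFrobeniusNormalized (toElemZero hF hsq) X ↔ IsFrobeniusNormalized (toElemGp hF hsq) X :=
  Iff.rfl

/-- Seat abc-iut-L1-t3's ops-level "`A` is birationally Frobenius-normalized" at THE birationalization
datum `biratData hF hsq` (Def. 4.5 (i), `IsBiratFrobeniusNormalizedObj`, stated for
`C^birat → F_{0_D}`) gives seat abc-iut-L6-t8's functor-level `IsBiratFrobeniusNormalized F hF hsq A`
(stated for `C^birat → F_{Φ^gp}`). [cite: MochizukiFrdI2008, Def. 4.5 (i) p.86] -/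
theorem isBiratFrobeniusNormalized_of_obj (hF : IsFrobenioid F) (hsq : HasBiratSquares F) (A : C)
    (h : PreFrobenioidData.IsBiratFrobeniusNormalizedObj (biratData hF hsq) A) :
    IsBiratFrobeniusNormalized F hF hsq A :=
  (isFrobeniusNormalized_toElemZero_iff hF hsq _).mp
    ((PreFrobenioidData.ofFunctor_isFrobeniusNormalized _ _).mp h)

/-- **`(C^istr)^birat → F_{0_D}` is a Frobenioid** whenever the Frobenioid `C` is of birationally
Frobenius-normalized type (Def. 4.5 (i), at THE birationalization): Prop. 4.4 (ii) (2024 form,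
isotropic case, seat abc-iut-w5-d227's `Birat.isFrobenioid`) for `C^istr`, which is of isotropic type
and — by the transfer `isFrobeniusNormalized_istr_of` along `(C^istr)^birat → C^birat` — of
birationally Frobenius-normalized type. This is the hypothesis `hB` of
`PreFrobenioidData.prop48iii_rationallyStandard`. [cite: MochizukiFrdI2008, Prop. 4.8 (iii) p.88] -/
theorem isFrobenioid_istrBirat_of_isOfBiratFrobeniusNormalizedType (hF : IsFrobenioid F)
    (hsq : HasBiratSquares F) (hsq' : HasBiratSquares (istrFunctor F))
    (h : PreFrobenioidData.IsOfBiratFrobeniusNormalizedType (biratData hF hsq)) :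
    IsFrobenioid (toElemZero (isFrobenioid_istr hF) hsq') :=
  isFrobenioid (isFrobenioid_istr hF) hsq' isOfIsotropicType_istr fun A =>
    (isFrobeniusNormalized_toElemZero_iff _ _ _).mp
      (isFrobeniusNormalized_istr_of (hF := hF) (hsq := hsq) (hsq' := hsq') A
        ((PreFrobenioidData.ofFunctor_isFrobeniusNormalized _ _).mp (h.obj A.obj)))

end Birat

end PreFrobenioid

namespace PreFrobenioidData

variable {D : Type u} [Category.{v} D] {Φ : Dᵒᵖ ⥤ CommMonCat.{w}}
  {C : Type u'} [Category.{v'} C] {F : C ⥤ ElemFrobenioid Φ}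

/-- **[FrdI] Prop. 4.8 (iii) at THE data, UNCONDITIONAL**: if the Frobenioid `C → F_Φ` is of rationally
standard type with respect to THE parameters `(C^birat, Supp, C^un-tr, (C^un-tr)^birat)` (Def. 4.5
(iii)), then `(C^istr)^birat → F_{0_D}` is of standard type. The former hypothesis `hB` of
`prop48iii_rationallyStandard` (Prop. 4.4 (ii) for `C^istr`) is supplied by
`Birat.isFrobenioid_istrBirat_of_isOfBiratFrobeniusNormalizedType` from clause (a) "birationally
Frobenius-normalized type" of the hypothesis itself. [cite: MochizukiFrdI2008, Prop. 4.8 (iii) p.88] -/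
theorem prop48iii_rationallyStandard_unconditional (hF : PreFrobenioid.IsFrobenioid F)
    (hsq : PreFrobenioid.HasBiratSquares F)
    (hsq' : PreFrobenioid.HasBiratSquares (PreFrobenioid.istrFunctor F))
    (Supp : ∀ {X : D}, (ofFunctor Φ F).Mon X → Primes ((ofFunctor Φ F).Mon X) → Prop)
    (hR : (ofFunctor Φ F).IsOfRationallyStandardType
      ⟨PreFrobenioid.biratData hF hsq, Supp, ofFunctor Φ (PreFrobenioid.untrFunctor hF),
        PreFrobenioid.biratData (PreFrobenioid.isFrobenioid_untr hF) (PreFrobenioid.hasBiratSquares_untr hF)⟩) :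
    (ofFunctor (zeroMonoid D)
      (PreFrobenioid.Birat.toElemZero (PreFrobenioid.isFrobenioid_istr hF) hsq')).IsOfStandardType :=
  prop48iii_rationallyStandard hF hsq hsq' Supp hR
    (PreFrobenioid.Birat.isFrobenioid_istrBirat_of_isOfBiratFrobeniusNormalizedType hF hsq hsq'
      hR.biratFrobNormalized)

/-- **[FrdI] Prop. 4.8 (iii) at THE data, UNCONDITIONAL, with the square-completion hypotheses of the
construction of `C^birat` and `(C^istr)^birat` also discharged** (Prop. 1.11 (vii), seat abc-iut-L6-t6's
`hasBiratSquares_of_isFrobenioid`): the statement now takes only the Frobenioid `C → F_Φ`, the support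
notion `Supp` of Def. 2.4 (i)(d), and "`C` is of rationally standard type".
[cite: MochizukiFrdI2008, Prop. 4.8 (iii) p.88] -/
theorem prop48iii_rationallyStandard' (hF : PreFrobenioid.IsFrobenioid F)
    (Supp : ∀ {X : D}, (ofFunctor Φ F).Mon X → Primes ((ofFunctor Φ F).Mon X) → Prop)
    (hR : (ofFunctor Φ F).IsOfRationallyStandardType
      ⟨PreFrobenioid.biratData hF (PreFrobenioid.hasBiratSquares_of_isFrobenioid hF), Supp,
        ofFunctor Φ (PreFrobenioid.untrFunctor hF),
        PreFrobenioid.biratData (PreFrobenioid.isFrobenioid_untr hF) (PreFrobenioid.hasBiratSquares_untr hF)⟩) :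
    (ofFunctor (zeroMonoid D)
      (PreFrobenioid.Birat.toElemZero (PreFrobenioid.isFrobenioid_istr hF)
        (PreFrobenioid.hasBiratSquares_of_isFrobenioid (PreFrobenioid.isFrobenioid_istr hF)))).IsOfStandardType :=
  prop48iii_rationallyStandard_unconditional hF _ _ Supp hR

end PreFrobenioidData

end Literature.AlgebraicGeometry.Frobenioids
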